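import Literature.Analysis.ODE.CompactSupportFlow
import Mathlib.Analysis.Calculus.InverseFunctionTheorem.ContDiff
import Mathlib.Geometry.Manifold.PartitionOfUnity
import Mathlib.Topology.MetricSpace.Thickening
import Mathlib.LinearAlgebra.FiniteDimensional.Basic
import Mathlib.Topology.Algebra.Module.FiniteDimension
import HarnessLib

/-!
# Isotopy extension for straight-line isotopies near a compact set (Hirsch, Ch. 8, Thm. 1.3)

Topic `Literature/Topology/FourManifolds` (differential topology in a finite-dimensional real
vector space `E`). We prove the following form of the **isotopy extension theorem** (Hirsch,
*Differential Topology* (1976), Ch. 8 §1, Thm. 1.3: an isotopy of a compact submanifold extends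
to a diffeotopy of the ambient manifold with compact support; Thm. 1.4: the version for open
subsets and compact `A ⊆ U`; both proved by integrating a compactly supported time-dependent
vector field, Thms. 1.1–1.2), specialised to the isotopies that occur in the uniqueness of
tubular neighbourhoods — straight-line isotopies `h_t = id + t (P - id)`:

* `Literature.Topology.FourManifolds.exists_diffeomorph_eqOn_nhdsSet_of_straightLine` — let `Z ⊆ E` be compact, `P` a `C^∞`
  map on an open neighbourhood `W` of `Z` with `P = id` on `Z`, and suppose that along `Z` the
  derivatives of all the maps `h_t = (1 - t) id + t P`, `0 ≤ t ≤ 1`, are injective. Then there is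
  a diffeomorphism `Φ` of `E` which **agrees with `P` on a neighbourhood of `Z`** and is the
  identity off a bounded set.

Proof (Hirsch, loc. cit.): near `[0, 1] × Z` the track `Ĥ(t, y) = (t, h_t y)` is an injective
local diffeomorphism (inverse function theorem; injectivity spreads from the compact set
`[0, 1] × Z`, where `Ĥ = id`, to a neighbourhood, `Literature.Topology.FourManifolds.exists_isOpen_injOn_of_isCompact`), hence a
diffeomorphism onto an open set `Ω ⊆ ℝ × E`; the time-dependent vector field
`X(t, y) = (P - id)(pr₂ Ĥ⁻¹(t, y))`, cut off to a compact subset of `Ω`, is tangent to the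
curves `t ↦ h_t(p)` for `p` near `Z`, so its flow from time `0` to time `1`
(`Literature.Analysis.ODE.tdFlowDiffeomorph`, `Literature/Analysis/ODE/CompactSupportFlow.lean`) is a
diffeomorphism of `E` equal to `h_1 = P` near `Z` (uniqueness of integral curves) and to the
identity off a ball (compact support).

## References

* M. W. Hirsch, *Differential Topology*, GTM 33, Springer (1976), Ch. 8 §1, Thms. 1.1–1.4.
  [Hirsch1976]
* A. Kosinski, *Differential Manifolds*, Academic Press (1993), Ch. II, Thm. (5.2) (isotopy
  extension), Ch. III, Thm. (3.5) (uniqueness of tubular neighbourhoods). [Kosinski1993]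

## Design notes

* The hypothesis on `P` along `Z` is stated with an arbitrary family of derivatives
  `D z` (`HasFDerivAt P (D z) z`) and plain injectivity of `id + t (D z - id)` (finite
  dimension turns it into invertibility).
* Everything in this file is proved; no named facts are introduced.
-/

noncomputable section

open Set Metric Filter Topology Function
open scoped ContDiff NNReal Manifold

namespace Literature.Topology.FourManifolds

universe u

/-! ### Injectivity near a compact set -/

/-- **Injectivity spreads from a compact set to a neighbourhood.** Let `f` be continuous at the
points of a compact set `K`, injective on `K` and locally injective at each point of `K` (values
in a Hausdorff space). Then `f` is injective on an open neighbourhood of `K`. (The pairs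
`(a, b)` with `f a = f b → a = b` form a neighbourhood of `K × K`; generalized tube lemma.)
Standard, e.g. in the proof of the tubular neighbourhood theorem, Kosinski (1993), III.(3.1);
Hirsch (1976), Ch. 4 §5, Ex. 5. [folklore] -/
theorem exists_isOpen_injOn_of_isCompact {X Y : Type*} [TopologicalSpace X] [TopologicalSpace Y]
    [T2Space Y] {f : X → Y} {K : Set X} (hK : IsCompact K) (hc : ∀ x ∈ K, ContinuousAt f x)
    (hinj : InjOn f K) (hloc : ∀ x ∈ K, ∃ U ∈ 𝓝 x, InjOn f U) :
    ∃ V : Set X, IsOpen V ∧ K ⊆ V ∧ InjOn f V := by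
  -- the set of "good pairs"
  set M : Set (X × X) := {p | f p.1 = f p.2 → p.1 = p.2} with hM
  have hnhds : ∀ p ∈ K ×ˢ K, M ∈ 𝓝 p := by
    rintro ⟨a, b⟩ ⟨ha, hb⟩
    by_cases hab : a = b
    · subst hab
      obtain ⟨U, hU, hU'⟩ := hloc a ha
      filter_upwards [prod_mem_nhds hU hU] with p hp
      exact fun hfp => hU' hp.1 hp.2 hfp
    · have hfab : f a ≠ f b := fun h => hab (hinj ha hb h)
      obtain ⟨A, B, hA, hB, hfa, hfb, hAB⟩ := t2_separation hfab
      filter_upwards [prod_mem_nhds ((hc a ha).preimage_mem_nhds (hA.mem_nhds hfa))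
        ((hc b hb).preimage_mem_nhds (hB.mem_nhds hfb))] with p hp
      intro hfp
      exact absurd hfp (disjoint_iff_forall_ne.1 hAB hp.1 hp.2)
  have hsub : K ×ˢ K ⊆ interior M := fun p hp => mem_interior_iff_mem_nhds.2 (hnhds p hp)
  obtain ⟨V₁, V₂, hV₁, hV₂, hKV₁, hKV₂, hVV⟩ :=
    generalized_tube_lemma hK hK isOpen_interior hsub
  refine ⟨V₁ ∩ V₂, hV₁.inter hV₂, subset_inter hKV₁ hKV₂, fun a ha b hb hfab => ?_⟩
  have hmem : (a, b) ∈ M := interior_subset (hVV ⟨ha.1, hb.2⟩)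
  exact hmem hfab

/-! ### The straight-line track and its derivative -/

section StraightLine

variable {E : Type u} [NormedAddCommGroup E] [NormedSpace ℝ E]

/-- The **straight-line isotopy** `h_t(y) = y + t (P y - y)` between the identity (`t = 0`) and
`P` (`t = 1`), as a function of `(t, y)`. Hirsch (1976), Ch. 8 §1. [folklore] -/
def slIsotopy (P : E → E) (t : ℝ) (y : E) : E := y + t • (P y - y)

/-- At time `0` the straight-line isotopy is the identity. [folklore] -/
@[simp]
theorem slIsotopy_zero (P : E → E) (y : E) : slIsotopy P 0 y = y := by simp [slIsotopy]

/-- At time `1` the straight-line isotopy is `P`. [folklore] -/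
@[simp]
theorem slIsotopy_one (P : E → E) (y : E) : slIsotopy P 1 y = P y := by simp [slIsotopy]

/-- On the fixed points of `P` the straight-line isotopy is stationary. [folklore] -/
theorem slIsotopy_of_eq (P : E → E) {y : E} (hy : P y = y) (t : ℝ) : slIsotopy P t y = y := by
  simp [slIsotopy, hy]

/-- Derivative of the straight-line isotopy at time `t`: `id + t (D - id)`. [folklore] -/
theorem hasFDerivAt_slIsotopy {P : E → E} (t : ℝ) {y : E} {D : E →L[ℝ] E}
    (hP : HasFDerivAt P D y) :
    HasFDerivAt (slIsotopy P t)
      (ContinuousLinearMap.id ℝ E + t • (D - ContinuousLinearMap.id ℝ E)) y :=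
  (hasFDerivAt_id y).add ((hP.sub (hasFDerivAt_id y)).const_smul t)

/-- The **track** `Ĥ(t, y) = (t, h_t y)` of the straight-line isotopy. Hirsch (1976), Ch. 8 §1.
[folklore] -/
def slTrack (P : E → E) (q : ℝ × E) : ℝ × E := (q.1, slIsotopy P q.1 q.2)

/-- The track, unfolded. [folklore] -/
@[simp]
theorem slTrack_apply (P : E → E) (t : ℝ) (y : E) : slTrack P (t, y) = (t, slIsotopy P t y) := rfl

/-- The track preserves the time coordinate. [folklore] -/
@[simp]
theorem slTrack_fst (P : E → E) (q : ℝ × E) : (slTrack P q).1 = q.1 := rfl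

/-- The partial derivative in `y` of the straight-line isotopy at time `t`, for a map with
derivative `D` at `y`: `id + t (D - id)`. [folklore] -/
def slDeriv (t : ℝ) (D : E →L[ℝ] E) : E →L[ℝ] E :=
  ContinuousLinearMap.id ℝ E + t • (D - ContinuousLinearMap.id ℝ E)

/-- The partial derivative, unfolded. [folklore] -/
@[simp]
theorem slDeriv_apply (t : ℝ) (D : E →L[ℝ] E) (η : E) : slDeriv t D η = η + t • (D η - η) := rfl

/-- Derivative of the straight-line isotopy at time `t`, as `slDeriv`. [folklore] -/
theorem hasFDerivAt_slIsotopy' {P : E → E} (t : ℝ) {y : E} {D : E →L[ℝ] E}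
    (hP : HasFDerivAt P D y) : HasFDerivAt (slIsotopy P t) (slDeriv t D) y :=
  hasFDerivAt_slIsotopy t hP

/-- The derivative of the track at `(t, y)`: `(τ, η) ↦ (τ, (id + t (D - id)) η + τ (P y - y))`.
[folklore] -/
def slTrackDeriv (t : ℝ) (D : E →L[ℝ] E) (w : E) : ℝ × E →L[ℝ] ℝ × E :=
  (ContinuousLinearMap.fst ℝ ℝ E).prod
    ((slDeriv t D).comp (ContinuousLinearMap.snd ℝ ℝ E) +
      (ContinuousLinearMap.fst ℝ ℝ E).smulRight w)

/-- The derivative of the track, unfolded. [folklore] -/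
@[simp]
theorem slTrackDeriv_apply (t : ℝ) (D : E →L[ℝ] E) (w : E) (q : ℝ × E) :
    slTrackDeriv t D w q = (q.1, slDeriv t D q.2 + q.1 • w) := rfl

/-- **Derivative of the track**: if `P` has derivative `D` at `y` then the track has derivative
`slTrackDeriv t D (P y - y)` at `(t, y)`. [folklore] -/
theorem hasFDerivAt_slTrack {P : E → E} {t : ℝ} {y : E} {D : E →L[ℝ] E}
    (hP : HasFDerivAt P D y) : HasFDerivAt (slTrack P) (slTrackDeriv t D (P y - y)) (t, y) := by
  have h1 : HasFDerivAt (fun q : ℝ × E => q.1) (ContinuousLinearMap.fst ℝ ℝ E) (t, y) :=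
    hasFDerivAt_fst
  have h2 : HasFDerivAt (fun q : ℝ × E => q.2) (ContinuousLinearMap.snd ℝ ℝ E) (t, y) :=
    hasFDerivAt_snd
  have hPc : HasFDerivAt (fun q : ℝ × E => P q.2 - q.2)
      (D.comp (ContinuousLinearMap.snd ℝ ℝ E) - ContinuousLinearMap.snd ℝ ℝ E) (t, y) :=
    (hP.comp (t, y) h2).sub h2
  have h3 := h1.smul hPc
  have h4 := h2.add h3
  have h5 := h1.prodMk h4
  refine h5.congr_fderiv ?_
  ext q <;> simp [slDeriv, smul_sub]

/-- When `id + t (D - id)` is invertible (given as a continuous linear equivalence `L`), the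
derivative of the track is the continuous linear equivalence
`(τ, η) ↦ (τ, L η + τ w)` (a shear). [folklore] -/
def slTrackEquiv (L : E ≃L[ℝ] E) (w : E) : (ℝ × E) ≃L[ℝ] ℝ × E :=
  (ContinuousLinearEquiv.refl ℝ ℝ).skewProd L ((ContinuousLinearMap.id ℝ ℝ).smulRight w)

/-- The shear equivalence is the derivative of the track. [folklore] -/
theorem coe_slTrackEquiv {t : ℝ} {D : E →L[ℝ] E} (L : E ≃L[ℝ] E)
    (hL : (L : E →L[ℝ] E) = slDeriv t D) (w : E) :
    (slTrackEquiv L w : ℝ × E →L[ℝ] ℝ × E) = slTrackDeriv t D w := by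
  refine ContinuousLinearMap.ext fun q => ?_
  obtain ⟨τ, η⟩ := q
  have hLη : L η = slDeriv t D η := by rw [← hL]; rfl
  simp [slTrackEquiv, hLη]

/-- The track is `C^n` on `ℝ × W` when `P` is `C^n` on `W`. [folklore] -/
theorem contDiffOn_slTrack {P : E → E} {W : Set E} {n : WithTop ℕ∞} (hP : ContDiffOn ℝ n P W) :
    ContDiffOn ℝ n (slTrack P) ((univ : Set ℝ) ×ˢ W) := by
  have h2 : ContDiffOn ℝ n (fun q : ℝ × E => q.2) ((univ : Set ℝ) ×ˢ W) := contDiffOn_snd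
  have hPW : ContDiffOn ℝ n (fun q : ℝ × E => P q.2) ((univ : Set ℝ) ×ˢ W) :=
    hP.comp h2 fun q hq => hq.2
  exact contDiffOn_fst.prodMk (h2.add (contDiffOn_fst.smul (hPW.sub h2)))

/-- The track fixes `(t, z)` whenever `P z = z`. [folklore] -/
theorem slTrack_of_eq (P : E → E) {z : E} (hz : P z = z) (t : ℝ) : slTrack P (t, z) = (t, z) := by
  simp [slIsotopy_of_eq P hz]

end StraightLine

/-! ### The extension theorem -/

section Extension

variable {E : Type u} [NormedAddCommGroup E] [NormedSpace ℝ E] [FiniteDimensional ℝ E]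

/-- In finite dimension an injective `id + t (D - id)` is a continuous linear equivalence.
[folklore] -/
theorem exists_equiv_slDeriv {t : ℝ} {D : E →L[ℝ] E} (h : Injective (slDeriv t D)) :
    ∃ L : E ≃L[ℝ] E, (L : E →L[ℝ] E) = slDeriv t D := by
  refine ⟨(LinearEquiv.ofInjectiveEndo (slDeriv t D).toLinearMap h).toContinuousLinearEquiv, ?_⟩
  ext η
  rfl

/-- **Isotopy extension for straight-line isotopies near a compact set** (Hirsch,
*Differential Topology* (1976), Ch. 8 §1, Thm. 1.3 / Thm. 1.4, for the isotopy
`h_t = id + t (P - id)`). Let `Z` be a compact subset of a finite-dimensional real normed space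
`E`, `P` a `C^∞` map on an open `W ⊇ Z` with `P z = z` on `Z`, with derivative `D z` at the
points of `Z`, such that `id + t (D z - id)` is injective for all `z ∈ Z`, `t ∈ [0, 1]`. Then
there is a diffeomorphism `Φ` of `E` with `Φ = P` on a neighbourhood of `Z` and `Φ = id` off a
ball. [cite: Hirsch1976, Ch. 8 §1, Thm. 1.3] -/
theorem exists_diffeomorph_eqOn_nhdsSet_of_straightLine {Z W : Set E} (hZ : IsCompact Z)
    (hW : IsOpen W) (hZW : Z ⊆ W) {P : E → E} (hP : ContDiffOn ℝ ∞ P W)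
    (hPZ : ∀ z ∈ Z, P z = z) {D : E → E →L[ℝ] E} (hD : ∀ z ∈ Z, HasFDerivAt P (D z) z)
    (hinj : ∀ z ∈ Z, ∀ t ∈ Icc (0 : ℝ) 1, Injective (slDeriv t (D z))) :
    ∃ Φ : E ≃ₘ⟮𝓘(ℝ, E), 𝓘(ℝ, E)⟯ E, (∀ᶠ y in 𝓝ˢ Z, Φ y = P y) ∧
      ∃ R : ℝ, ∀ y : E, R ≤ ‖y‖ → Φ y = y := by
  have hPdiff : ∀ y ∈ W, HasFDerivAt P (fderiv ℝ P y) y := fun y hy =>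
    ((hP.contDiffAt (hW.mem_nhds hy)).differentiableAt (by simp)).hasFDerivAt
  have hDeq : ∀ z ∈ Z, fderiv ℝ P z = D z := fun z hz => (hD z hz).fderiv
  -- Step 1: the set `S` of `(t, y)`, `y ∈ W`, where `id + t (DP(y) - id)` is invertible is open
  set A : ℝ × E → E →L[ℝ] E := fun q => slDeriv q.1 (fderiv ℝ P q.2) with hA
  have hAcont : ContinuousOn A ((univ : Set ℝ) ×ˢ W) := by
    have hf : ContinuousOn (fun q : ℝ × E => fderiv ℝ P q.2) ((univ : Set ℝ) ×ˢ W) :=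
      (hP.continuousOn_fderiv_of_isOpen hW (by simp)).comp continuousOn_snd fun q hq => hq.2
    simp only [hA, slDeriv]
    exact continuousOn_const.add (continuousOn_fst.smul (hf.sub continuousOn_const))
  set S : Set (ℝ × E) := ((univ : Set ℝ) ×ˢ W) ∩ A ⁻¹' {u | IsUnit u} with hS
  have hSopen : IsOpen S := hAcont.isOpen_inter_preimage (isOpen_univ.prod hW) Units.isOpen
  -- the equivalences `T q` and the derivative of the track on `S`
  have hequiv : ∀ q ∈ S, ∃ T : (ℝ × E) ≃L[ℝ] ℝ × E,
      HasFDerivAt (slTrack P) (T : ℝ × E →L[ℝ] ℝ × E) q := by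
    rintro ⟨t, y⟩ ⟨⟨-, hyW⟩, hunit⟩
    have hunit' : IsUnit (slDeriv t (fderiv ℝ P y)) := hunit
    set L : E ≃L[ℝ] E := ContinuousLinearEquiv.unitsEquiv ℝ E hunit'.unit with hL
    have hLcoe : (L : E →L[ℝ] E) = slDeriv t (fderiv ℝ P y) := by
      rw [hL]; ext η; simp
    refine ⟨slTrackEquiv L (P y - y), ?_⟩
    rw [coe_slTrackEquiv L hLcoe]
    exact hasFDerivAt_slTrack (hPdiff y hyW)
  have hKS : Icc (0 : ℝ) 1 ×ˢ Z ⊆ S := by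
    rintro ⟨t, z⟩ ⟨ht, hz⟩
    refine ⟨⟨mem_univ _, hZW hz⟩, ?_⟩
    show IsUnit (slDeriv t (fderiv ℝ P z))
    rw [hDeq z hz]
    obtain ⟨L, hL⟩ := exists_equiv_slDeriv (hinj z hz t ht)
    exact ⟨ContinuousLinearEquiv.toUnit L, by rw [← hL]; rfl⟩
  -- Step 2: injectivity of the track near `[0, 1] × Z`
  have hK : IsCompact (Icc (0 : ℝ) 1 ×ˢ Z) := isCompact_Icc.prod hZ
  have htrack_cont : ContinuousOn (slTrack P) ((univ : Set ℝ) ×ˢ W) :=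
    (contDiffOn_slTrack hP).continuousOn
  have htrack_at : ∀ q ∈ S, ContDiffAt ℝ ∞ (slTrack P) q := fun q hq =>
    (contDiffOn_slTrack hP).contDiffAt ((isOpen_univ.prod hW).mem_nhds hq.1)
  obtain ⟨V, hVopen, hKV, hVinj⟩ : ∃ V : Set (ℝ × E), IsOpen V ∧ Icc (0 : ℝ) 1 ×ˢ Z ⊆ V ∧
      InjOn (slTrack P) V := by
    refine exists_isOpen_injOn_of_isCompact hK (fun q hq => ?_) (fun q hq q' hq' h => ?_)
      (fun q hq => ?_)
    · exact (htrack_at q (hKS hq)).continuousAt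
    · obtain ⟨t, z⟩ := q
      obtain ⟨t', z'⟩ := q'
      rw [slTrack_of_eq P (hPZ z hq.2), slTrack_of_eq P (hPZ z' hq'.2)] at h
      exact h
    · obtain ⟨T, hT⟩ := hequiv q (hKS hq)
      have hstrict : HasStrictFDerivAt (slTrack P) (T : ℝ × E →L[ℝ] ℝ × E) q := by
        have h1 := (htrack_at q (hKS hq)).hasStrictFDerivAt (by simp)
        rwa [hT.fderiv] at h1
      exact ⟨_, (hstrict.toOpenPartialHomeomorph _).open_source.mem_nhds
        hstrict.mem_toOpenPartialHomeomorph_source,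
        (hstrict.toOpenPartialHomeomorph _).injOn⟩
  -- Step 3: a product neighbourhood `J × U` of `[0, 1] × Z` inside `S ∩ V`
  obtain ⟨J₀, U₀, hJ₀, hU₀, hIJ₀, hZU₀, hJU₀⟩ :=
    generalized_tube_lemma isCompact_Icc hZ (hSopen.inter hVopen)
      (subset_inter hKS hKV)
  obtain ⟨δ, hδ, hδJ⟩ := isCompact_Icc.exists_thickening_subset_open hJ₀ hIJ₀
  set J : Set ℝ := Ioo (-δ) (1 + δ) with hJ
  have hJsub : J ⊆ J₀ := by
    intro s hs
    apply hδJ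
    rw [mem_thickening_iff]
    rcases le_or_gt s 0 with h0 | h0
    · refine ⟨0, left_mem_Icc.2 zero_le_one, ?_⟩
      rw [dist_comm, Real.dist_eq, zero_sub, abs_neg, abs_of_nonpos h0]
      linarith [hs.1]
    rcases le_or_gt s 1 with h1 | h1
    · exact ⟨s, ⟨h0.le, h1⟩, by rw [dist_self]; exact hδ⟩
    · refine ⟨1, right_mem_Icc.2 zero_le_one, ?_⟩
      rw [Real.dist_eq, abs_of_pos (by linarith)]
      linarith [hs.2]
  obtain ⟨R₀, hR₀⟩ := hZ.isBounded.subset_ball 0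
  set U : Set E := U₀ ∩ ball 0 R₀ with hU
  have hUopen : IsOpen U := hU₀.inter isOpen_ball
  have hZU : Z ⊆ U := subset_inter hZU₀ hR₀
  set O : Set (ℝ × E) := J ×ˢ U with hO
  have hOopen : IsOpen O := isOpen_Ioo.prod hUopen
  have hOS : O ⊆ S := fun q hq => (hJU₀ ⟨hJsub hq.1, hq.2.1⟩).1
  have hOV : O ⊆ V := fun q hq => (hJU₀ ⟨hJsub hq.1, hq.2.1⟩).2
  have h0J : (0 : ℝ) ∈ J := ⟨by linarith, by linarith⟩
  have hUW : U ⊆ W := fun y hy => by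
    have : ((0 : ℝ), y) ∈ S := hOS ⟨h0J, hy⟩
    exact this.1.2
  -- Step 4: the track as a partial diffeomorphism `e : O ≅ Ω`
  have hOinj : InjOn (slTrack P) O := hVinj.mono hOV
  set e₀ : PartialEquiv (ℝ × E) (ℝ × E) := hOinj.toPartialEquiv (slTrack P) O with he₀
  have hopenmap : IsOpenMap (O.restrict (slTrack P)) := by
    rw [isOpenMap_iff_nhds_le]
    rintro ⟨q, hq⟩
    obtain ⟨T, hT⟩ := hequiv q (hOS hq)
    have hstrict : HasStrictFDerivAt (slTrack P) (T : ℝ × E →L[ℝ] ℝ × E) q := by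
      have h1 := (htrack_at q (hOS hq)).hasStrictFDerivAt (by simp)
      rwa [hT.fderiv] at h1
    have hmap : map (O.restrict (slTrack P)) (𝓝 ⟨q, hq⟩) = map (slTrack P) (𝓝 q) := by
      rw [restrict_eq, ← Filter.map_map, map_nhds_subtype_val, hOopen.nhdsWithin_eq hq]
    rw [hmap, hstrict.map_nhds_eq_of_equiv]
    exact le_rfl
  set e : OpenPartialHomeomorph (ℝ × E) (ℝ × E) :=
    OpenPartialHomeomorph.ofContinuousOpenRestrict e₀
      (htrack_cont.mono fun q hq => ⟨mem_univ _, hUW hq.2⟩) hopenmap hOopen with he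
  have hecoe : ⇑e = slTrack P := rfl
  have hesource : e.source = O := rfl
  have hesymm_smooth : ContDiffOn ℝ ∞ e.symm e.target := by
    intro b hb
    have hb' : e.symm b ∈ O := e.map_target hb
    obtain ⟨T, hT⟩ := hequiv _ (hOS hb')
    exact (e.contDiffAt_symm hb hT (htrack_at _ (hOS hb'))).contDiffWithinAt
  -- Step 5: the vector field on `Ω = e.target` and its cutoff
  set Ω : Set (ℝ × E) := e.target with hΩ
  have hΩopen : IsOpen Ω := e.open_target
  set Y : ℝ × E → E := fun q => P (e.symm q).2 - (e.symm q).2 with hY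
  have hYsmooth : ContDiffOn ℝ ∞ Y Ω := by
    have h2 : ContDiffOn ℝ ∞ (fun q => (e.symm q).2) Ω := hesymm_smooth.snd
    have hmaps : MapsTo (fun q => (e.symm q).2) Ω W := fun q hq => hUW (e.map_target hq).2
    exact (hP.comp h2 hmaps).sub h2
  -- a compact neighbourhood `Zc` of `Z` in `U` and the compact set `C'` of the track
  obtain ⟨Zc, hZc, hZZc, hZcU⟩ := exists_compact_between hZ hUopen hZU
  set C' : Set (ℝ × E) := slTrack P '' (Icc (-(δ / 2)) (1 + δ / 2) ×ˢ Zc) with hC'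
  have hIccJ : Icc (-(δ / 2)) (1 + δ / 2) ⊆ J := fun s hs =>
    ⟨by linarith [hs.1], by linarith [hs.2]⟩
  have hCO : Icc (-(δ / 2)) (1 + δ / 2) ×ˢ Zc ⊆ O := prod_mono hIccJ hZcU
  have hC'cpt : IsCompact C' := (isCompact_Icc.prod hZc).image_of_continuousOn
    ((htrack_cont.mono fun q hq => ⟨mem_univ _, hUW hq.2⟩).mono hCO)
  have hC'Ω : C' ⊆ Ω := by
    rintro _ ⟨q, hq, rfl⟩
    exact e.map_source (show q ∈ e.source from hCO hq)
  obtain ⟨t₁, ht₁, hC't₁, ht₁Ω⟩ := exists_compact_between hC'cpt hΩopen hC'Ω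
  obtain ⟨ρ, hρ1, hρ0, hρ01⟩ := exists_contMDiffMap_one_nhds_of_subset_interior 𝓘(ℝ, ℝ × E)
    hC'cpt.isClosed hC't₁ (n := (⊤ : ℕ∞))
  have hρsmooth : ContDiff ℝ ∞ (ρ : ℝ × E → ℝ) := contMDiff_iff_contDiff.1 ρ.contMDiff
  set X : ℝ × E → E := fun q => (ρ q) • Y q with hX
  have hXsmooth : ContDiff ℝ ∞ X := by
    refine contDiff_iff_contDiffAt.2 fun q => ?_
    by_cases hq : q ∈ Ω
    · exact (hρsmooth.contDiffAt).smul (hYsmooth.contDiffAt (hΩopen.mem_nhds hq))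
    · have hq' : q ∉ t₁ := fun h => hq (ht₁Ω h)
      have hev : X =ᶠ[𝓝 q] fun _ => 0 := by
        filter_upwards [ht₁.isClosed.isOpen_compl.mem_nhds hq'] with q' hq''
        simp only [hX, hρ0 q' hq'', zero_smul]
      exact contDiffAt_const.congr_of_eventuallyEq hev
  have hXsupp : HasCompactSupport X := by
    refine HasCompactSupport.of_support_subset_isCompact ht₁ fun q hq => ?_
    by_contra hq'
    exact hq (by simp only [hX, hρ0 q hq', zero_smul])
  -- Step 6: the flow
  have hn : (1 : ℕ∞) ≤ ⊤ := le_top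
  set Φ := Literature.Analysis.ODE.tdFlowDiffeomorph hXsmooth hXsupp hn 0 1 with hΦ
  refine ⟨Φ, ?_, ?_⟩
  · -- agreement with `P` on `interior Zc`
    have hagree : ∀ p ∈ interior Zc, Φ p = P p := by
      intro p hp
      have hpZc : p ∈ Zc := interior_subset hp
      -- the straight line `s ↦ h_s p` is an integral curve of `X` on `(-δ/2, 1 + δ/2)`
      have hcurve : ∀ s ∈ Ioo (-(δ / 2)) (1 + δ / 2),
          HasDerivAt (fun s => slIsotopy P s p) (X (s, slIsotopy P s p)) s := by
        intro s hs
        have hsO : (s, p) ∈ O := hCO ⟨Ioo_subset_Icc_self hs, hpZc⟩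
        have hval : X (s, slIsotopy P s p) = P p - p := by
          have hmemC' : (s, slIsotopy P s p) ∈ C' := ⟨(s, p), ⟨Ioo_subset_Icc_self hs, hpZc⟩, rfl⟩
          have hρq : ρ (s, slIsotopy P s p) = 1 := hρ1.self_of_nhdsSet _ hmemC'
          have hsymm : e.symm (s, slIsotopy P s p) = (s, p) := by
            have := e.left_inv (show (s, p) ∈ e.source from hsO)
            simpa [hecoe] using this
          simp only [hX, hY, hρq, one_smul, hsymm]
        rw [hval]
        have h1 : HasDerivAt (fun s : ℝ => s • (P p - p)) ((1 : ℝ) • (P p - p)) s :=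
          (hasDerivAt_id s).smul_const _
        rw [one_smul] at h1
        have h2 := h1.const_add p
        exact h2
      have key := Literature.Analysis.ODE.tdFlow_eq_of_hasDerivAt hXsmooth hXsupp hn (γ := fun s => slIsotopy P s p)
        (a := -(δ / 2)) (b := 1 + δ / 2) (t₀ := 0) ⟨by linarith, by linarith⟩ hcurve (t := 1)
        ⟨by linarith, by linarith⟩
      simp only [slIsotopy_zero, slIsotopy_one] at key
      rw [hΦ, Literature.Analysis.ODE.coe_tdFlowDiffeomorph]
      exact key
    exact Filter.eventually_of_mem (isOpen_interior.mem_nhdsSet.2 hZZc) hagree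
  · obtain ⟨R, hR⟩ := Literature.Analysis.ODE.exists_forall_le_norm_tdFlow_eq_self hXsmooth hXsupp hn
    exact ⟨R, fun y hy => by rw [hΦ, Literature.Analysis.ODE.coe_tdFlowDiffeomorph]; exact hR y hy 0 1⟩

end Extension

end Literature.Topology.FourManifolds

end
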